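import Summits.Ventures.LatticeQCDFlow.Scaling.SectorRefreshBudgetFloor
import Summits.Ventures.LatticeQCDFlow.Scaling.RefreshBudgetFloor

/-!
HONEST FRAMING: exact (Metropolis-corrected) sampling algorithms for lattice gauge theory; figures
of merit are autocorrelation/cost numbers at stated couplings and volumes; no continuum-physics
claim.

# PureSwapNeverMixes — SWAPS ALONE, HOWEVER GOOD THE FLOWS, NEVER MIX: AT SWAP FRACTION `t = 1` AN EXCHANGE SCHEME WITH
# SECTOR-PRESERVING MAPS (IN PARTICULAR IDENTITY MAPS) HAS `d(n) ≥ 1 − Σ_k μ_k(A)` FOR EVERY `n`, ON EVERY SWAP LIST —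
# THE SINGLE-REPLICA UPDATES DO ALL THE TUNNELLING (lean-2 GEN-26, ours)

Venture-side (OURS).  Cell `lqcd-flow` (pub-lqcd), unit `pub-lqcd-lean-2-g26`, 2026-08-27.  Chapter M, file 30 — the
`t = 1` endpoint of `Scaling/RefreshBudgetFloor` and `Scaling/SectorRefreshBudgetFloor`: with no updates the swap graph,
the proposal law and the transports are powerless against a sector the maps preserve.

## What is proved

* **`pureSwap_sector_worstTvDist_ge`** — `A`-preserving maps, any swap list, `t = 1`, a start with every replica in `A`:
  **`d(n) ≥ 1 − Σ_k μ_k(A)` for every `n`**; **`pureSwap_worstTvDist_ge`** — identity maps, any state `s`: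
  `d(n) ≥ 1 − Σ_k μ_k(s)`; **`pureSwap_not_mixed`** — if `Σ_k μ_k(A) < 1 − ε` then `d(n) > ε` for all `n`
  (no finite `ε`-mixing time is witnessed).

Reading (no numerics implied): a flow that cannot change the topological sector cannot be rescued by swapping
harder; the refresh budget of the companion files quantifies how many updates the `ε`-mixing needs.  NOT CLAIMED:
sector-changing maps (then the count moves and the statement is void, as it should be); anything measured.
Literature grade (cell rule): OWN COROLLARY; nothing cited as a fact; no new bib keys.
-/

noncomputable section

open Finset Function
open Literature.Probability.MarkovChains

namespace Summit.Ventures.LatticeQCDFlow.Scaling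

variable {S : Type*} [Fintype S] [DecidableEq S] {K m : ℕ} {μ : Fin (K + 1) → S → ℝ} {M : Fin (K + 1) → S → S → ℝ}
  {w : Fin (K + 1) → ℝ} {e : Fin m → Fin (K + 1) × Fin (K + 1)} {φ : Fin m → Equiv.Perm S} {A : Finset S}

/-- **PURE SWAPPING WITH SECTOR-PRESERVING MAPS NEVER MIXES: `d(n) ≥ 1 − Σ_k μ_k(A)` for every `n`** (`t = 1`, any
swap list, any update weights and kernels — they are never used — a start with every replica in `A`). [ours] -/
theorem pureSwap_sector_worstTvDist_ge (hm : 1 ≤ m) (he : ∀ r, (e r).1 ≠ (e r).2) (hμ : ∀ k x, 0 < μ k x)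
    (hμ1 : ∀ k, ∑ u, μ k u = 1) (hM : ∀ k, IsRowStochastic (M k)) (hw0 : ∀ k, 0 ≤ w k) (hw1 : ∑ k, w k = 1)
    (hφA : ∀ r u, φ r u ∈ A ↔ u ∈ A) (x : Fin (K + 1) → S) (hx : ∀ k, x k ∈ A) (n : ℕ) :
    1 - ∑ k, ∑ u ∈ A, μ k u
      ≤ worstTvDist (fun y z : Fin (K + 1) → S => 1 * ptGraphSwap μ e φ y z + (1 - 1) * prodKernel w M y z)
          (tensorFun μ) n := by
  have h := sectorBudget_worstTvDist_ge (A := A) (e := e) (M := M) (w := w) (t := 1) hm he hμ hμ1 hM hw0 hw1 zero_le_one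
    le_rfl hφA x hx n
  have e0 : ((n : ℕ) : ℝ) * (1 - 1) / (K + 1) = 0 := by rw [sub_self, mul_zero, zero_div]
  rw [e0, sub_zero] at h
  exact h

/-- **PURE SWAPPING WITH IDENTITY MAPS NEVER MIXES: `d(n) ≥ 1 − Σ_k μ_k(s)` for every `n`** (plain replica exchange at
`t = 1`, any swap list). [ours] -/
theorem pureSwap_worstTvDist_ge (hm : 1 ≤ m) (he : ∀ r, (e r).1 ≠ (e r).2) (hμ : ∀ k x, 0 < μ k x)
    (hμ1 : ∀ k, ∑ u, μ k u = 1) (hM : ∀ k, IsRowStochastic (M k)) (hw0 : ∀ k, 0 ≤ w k) (hw1 : ∑ k, w k = 1)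
    (s : S) (n : ℕ) :
    1 - ∑ k, μ k s
      ≤ worstTvDist (fun y z : Fin (K + 1) → S =>
          1 * ptGraphSwap μ e (fun _ => Equiv.refl S) y z + (1 - 1) * prodKernel w M y z) (tensorFun μ) n := by
  have h := refreshBudget_worstTvDist_ge (e := e) (M := M) (w := w) (t := 1) hm he hμ hμ1 hM hw0 hw1 zero_le_one le_rfl
    s n
  have e0 : ((n : ℕ) : ℝ) * (1 - 1) / (K + 1) = 0 := by rw [sub_self, mul_zero, zero_div]
  rw [e0, sub_zero] at h
  exact h

/-- **NO FINITE MIXING TIME IS WITNESSED:** if the sector is rare at every level, `Σ_k μ_k(A) < 1 − ε`, then the pure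
swap scheme with `A`-preserving maps has `d(n) > ε` for EVERY `n`. [ours] -/
theorem pureSwap_not_mixed (hm : 1 ≤ m) (he : ∀ r, (e r).1 ≠ (e r).2) (hμ : ∀ k x, 0 < μ k x)
    (hμ1 : ∀ k, ∑ u, μ k u = 1) (hM : ∀ k, IsRowStochastic (M k)) (hw0 : ∀ k, 0 ≤ w k) (hw1 : ∑ k, w k = 1)
    (hφA : ∀ r u, φ r u ∈ A ↔ u ∈ A) (x : Fin (K + 1) → S) (hx : ∀ k, x k ∈ A) {ε : ℝ}
    (hrare : ∑ k, ∑ u ∈ A, μ k u < 1 - ε) (n : ℕ) :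
    ε < worstTvDist (fun y z : Fin (K + 1) → S => 1 * ptGraphSwap μ e φ y z + (1 - 1) * prodKernel w M y z)
          (tensorFun μ) n := by
  have h := pureSwap_sector_worstTvDist_ge (A := A) (e := e) (M := M) (w := w) hm he hμ hμ1 hM hw0 hw1 hφA x hx n
  linarith

end Summit.Ventures.LatticeQCDFlow.Scaling

end
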